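import Summits.BirchSwinnertonDyer.Rank1Residual.X2.RankOneHeegner
import Literature.NumberTheory.EllipticCurves.HeegnerPointsExistenceProofs
import HarnessLib

/-!
# Class X2, rank `1` (sub-cell X2c): the class-level statements from the typed input over `K`
# (cell `b2b-bsdres`, unit `b2b-bsdres-eisenstein-p2`, gen 2)

HONEST FRAMING (run/shared/lean/b2b/bsd-rank1-residual/, verbatim in every file): the goal of the
cell is to DELETE the COMBINATION-SHAPED residual classes of the Birch–Swinnerton-Dyer formula for
ALL analytic-rank `≤ 1` elliptic curves over `ℚ` — "full BSD formula for every rank `≤ 1` curve in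
class `C`" assembled STRICTLY from published theorems — so that the rank-`≤ 1` remainder becomes
exactly the CONSTRUCTION-SHAPED classes, which are TYPED (missing-input `Prop`s), NOT attempted.
This is not "finishing BSD". Research routes; no claim beyond stated classes. Sub-cell X2c stays
CONSTRUCTION-SHAPED; no label changes.

Class-level form of `X2/RankOneHeegner.lean`, in the format of
`X11b.bsdp_of_classX11b_of_locus_of_transport` (p200200): PUBLISHED named facts as binders —
Gross–Zagier (`gross_zagier`), Kolyvagin (`kolyvagin`), Gross–Zagier–Kolyvagin over `ℚ`, modularity
(`exists_isNewformOf`), Hoffstein–Luo / Bump–Friedberg–Hoffstein (the admissible field, x1a's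
`exists_admissibleField_of_rootNumber_eq_neg_one`), the `K`-rationality of Heegner points
(`heegnerPointComplex_mem_range_map`, Gross 1984 / Darmon 2004 Thm. 3.7) and, for the partner, the
X2a facts of `X2/RankZero.lean`; the Heegner datum itself is the tree THEOREM
`nonempty_heegnerDatum_holds`; ONE transport package as an inline hypothesis
(`TwistTransportPackage`: the two decidable values `ord_p ∏c_ℓ(E^{d_K}) = ord_p ∏c_ℓ(E)` and
`ord_p u = 0` for every globally minimal model of the twist — Jetchev–Skinner–Wan 2017 (eq:tamK);
true for `d_K` odd and `p` odd: `c_ℓ` agree at the split `ℓ ∣ N`, lie in `{1,2,4}` at the odd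
`ℓ ∣ d_K` (type `I₀*`), and both models are minimal at `p`; not yet a tree theorem); a PER-PAIR
Manin condition `HasPrimeToManinDatum W p` (some modular parametrisation of `E` of level `N_E` has
Manin constant prime to `p`: Mazur 1978 / Agashe–Ribet–Stein 2006 Thm. 2.6 give it for the
`X₀(N)`-OPTIMAL curve at an odd `p ‖ N`; the other members of the isogeny class are reached by
`X2.CellC.of_isIsogenous` + `X2.bsdp_of_isIsogenous_of_bsdp` (Cassels) — at an Eisenstein prime the
isogeny may have degree divisible by `p`, so the condition is NOT automatic for them); and the typed
input `X2.HeegnerIndexIdentity`. Theorems: `bsdp_of_cellC_of_manin_of_partner` (generic partner),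
`bsdp_of_cellC_of_not_gvPar_of_manin` (ψ even: partner in the CLOSED sub-cell X2a),
`targetC_of_heegnerIndexIdentity_of_manin_of_targetB`, and
`target_of_published_of_missingInputB_of_heegnerIndexIdentity` (what remains of X2 in the kernel:
published facts + Mazur's main conjecture at the X2b pairs + the identity over `K` + the transport
package + the Manin condition on every CellC pair).

References: [CastellaEtAl2021] Thm. 5.3.1; [JetchevSkinnerWan2017] §7.4; [KellerYin2024] (PRE)
Thm. 5.0.4; [AgasheRibetStein2006] Thm. 2.6; [Darmon2004] Thm. 3.6–3.7; [Miller2011LMS] Def. 1.1.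
-/

set_option autoImplicit false

noncomputable section

open scoped Classical MatrixGroups ModularForm

open CongruenceSubgroup WeierstrassCurve NumberField Literature.NumberTheory.EllipticCurves
  Literature.NumberTheory.EllipticCurves.ModularForms Literature.NumberTheory.QuadraticFields
  Literature.NumberTheory.EllipticCurves.Rank1Residual
  Literature.NumberTheory.EllipticCurves.Rank1Residual.Typed
  Literature.NumberTheory.EllipticCurves.GreenbergVatsal2000
  Literature.NumberTheory.EllipticCurves.Wuthrich2014
  Literature.NumberTheory.EllipticCurves.SteinWuthrich2013

namespace Summit.BirchSwinnertonDyer.Rank1Residual.X2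

/-! ### The per-pair Manin condition and the transport package -/

/-- **The per-pair Manin condition**: `E` (model `W`) admits a modular parametrisation datum of level
`N_E` whose Manin constant is prime to `p`. Holds for the `X₀(N)`-optimal curve at an odd `p ‖ N`
(Mazur 1978; Agashe–Ribet–Stein 2006 Thm. 2.6: `p ∣ c ⇒ p² ∣ 4N`); NOT automatic for the other curves
of an isogeny class at an Eisenstein prime. A predicate; nothing asserted.
[cite: AgasheRibetStein2006, Thm. 2.6 (statement only; a hypothesis here)] -/
def HasPrimeToManinDatum (W : WeierstrassCurve ℚ) (p : ℕ) : Prop :=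
  ∀ [NeZero (W.conductorNorm ℤ)],
    ∃ Dt : ModularParametrizationData W (W.conductorNorm ℤ), ¬ (p : ℤ) ∣ Dt.c

/-- **Transport package** (hypothesis shape): for a CellC pair and an admissible `K` (`d_K` odd, every
`ℓ ∣ N` split), EVERY globally minimal model `Wd = Cd • E^{(d_K)}` has
`ord_p ∏_ℓ c_ℓ(Wd) = ord_p ∏_ℓ c_ℓ(W)` (`c_ℓ` equal at `ℓ ∣ N` since `d_K ∈ ℤ_ℓ^{×2}`; `c_ℓ ∈ {1,2,4}`
at the odd `ℓ ∣ d_K`, where `E^{(d_K)}` has type `I₀*`) and `ord_p u(Cd) = 0` (the twisted equation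
is already minimal at `p ∤ d_K`). Jetchev–Skinner–Wan 2017 (eq:tamK); items (d), (e) of the X11b
route's list — true for `d_K` odd and `p` odd, decidable per pair, not yet a tree theorem. A
predicate; nothing asserted.
[cite: JetchevSkinnerWan2017, §7.4.1 (eq:tamK), p. 30] -/
def TwistTransportPackage : Prop :=
  ∀ (W : WeierstrassCurve ℚ) [W.IsElliptic] [W.IsGloballyMinimal] (p : ℕ) [Fact p.Prime]
    (K : Type) [Field K] [NumberField K] (Wd : WeierstrassCurve ℚ) [Wd.IsElliptic]
    [Wd.IsGloballyMinimal] (Cd : VariableChange ℚ),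
    CellC W p → IsImaginaryQuadratic K → Odd (NumberField.discr K) →
    SatisfiesHeegnerHypothesis (W.conductorNorm ℤ) K →
    Cd • W.quadraticTwist (NumberField.discr K : ℚ) = Wd →
    padicValNat p Wd.tamagawaProduct = padicValNat p W.tamagawaProduct ∧
      padicValRat p (Cd.u : ℚ) = 0

/-- **X2c ⇒ `BSD(E,p)` at a pair, from the typed input over `K`, the Manin condition, the transport
package and a partner supply** — the assembly of CGLS 2022 Thm. 5.3.1 / JSW 2017 §7.4.1 at
`p ‖ N`: `w(E) = −1` (modularity); an admissible `K` (`d_K` odd `< −4`, Heegner hypothesis for `N_E`, `p` split,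
`L(E^{d_K},1) ≠ 0`: x1a's `exists_admissibleField_of_rootNumber_eq_neg_one`, Hoffstein–Luo); the
datum of `hMan`, a Heegner datum (`nonempty_heegnerDatum_holds`) and its `K`-rational Heegner point
(`hHP`); a global minimal model of the twist (Néron) with `hTw`'s two values; the partner's print
shape; then `bsdp_of_cellC_of_indexIdentityAt`. [cite: Darmon2004, Thm. 3.6–3.7 (PDF pp. 43–44)]
[cite: CastellaEtAl2021, Thm. 5.3.1] [cite: JetchevSkinnerWan2017, §7.4.1 (pp. 30–31)]
[cite: Miller2011LMS, Def. 1.1] -/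
theorem bsdp_of_cellC_of_manin_of_partner
    (hGZ : ∀ (N : ℕ) [NeZero N] (W : WeierstrassCurve ℚ) (K : Type) [Field K] [NumberField K],
      gross_zagier N W K)
    (hKo : ∀ (N : ℕ) [NeZero N] (W : WeierstrassCurve ℚ) (K : Type) [Field K] [NumberField K],
      kolyvagin N W K)
    (hHP : ∀ (N : ℕ) [NeZero N] (W : WeierstrassCurve ℚ) (K : Type) [Field K] [NumberField K],
      heegnerPointComplex_mem_range_map N W K)
    (hGZK : rank_eq_analyticRank_of_analyticRank_le_one) (hnf : exists_isNewformOf)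
    (hHL : HoffsteinLuo1997_exists_twist_L_one_ne_zero)
    (hTw : TwistTransportPackage) (hHI : HeegnerIndexIdentity)
    (W : WeierstrassCurve ℚ) [W.IsElliptic] [W.IsGloballyMinimal] (p : ℕ) [Fact p.Prime]
    (hc : CellC W p) (hMan : HasPrimeToManinDatum W p)
    (hpartner : ∀ (K : Type) [Field K] [NumberField K], IsImaginaryQuadratic K →
        Odd (NumberField.discr K) → NumberField.discr K < -4 →
        SatisfiesHeegnerHypothesis (W.conductorNorm ℤ) K → SatisfiesHeegnerHypothesis p K →
        (W.quadraticTwist (NumberField.discr K : ℚ)).entireLFunction 1 ≠ 0 →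
      ∀ (Wd : WeierstrassCurve ℚ) [Wd.IsElliptic] [Wd.IsGloballyMinimal],
        (∃ C : VariableChange ℚ, C • Wd = W.quadraticTwist (NumberField.discr K : ℚ)) →
        Wd.analyticRank = 0 → PPartRankZero Wd p) :
    BSDp W p := by
  have hp : p.Prime := Fact.out
  have hmod : hasEntireLFunction_rat := WeierstrassCurve.hasEntireLFunction_rat_of_exists_isNewformOf hnf
  obtain ⟨hr, hp2, hred, hmult⟩ := hc
  haveI : NeZero (W.conductorNorm ℤ) := ⟨(W.conductorNorm_pos_holds).ne'⟩
  -- `w(E) = -1`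
  have hw : W.rootNumber = -1 := by
    rw [WeierstrassCurve.rootNumber_eq_neg_one_pow_analyticRank_of_exists_isNewformOf hnf W, hr]
    norm_num
  -- the admissible auxiliary field
  obtain ⟨K, _, _, hK, hodd, hlt, hHN, hHp, hLK⟩ :=
    exists_admissibleField_of_rootNumber_eq_neg_one hnf hHL W hw p
  -- the datum with `p ∤ c` (hypothesis), a Heegner datum (tree theorem) and the Heegner point
  -- (`K`-rationality: Gross 1984 / Darmon 2004, named fact `hHP`)
  obtain ⟨Dt, hcM⟩ := hMan
  obtain ⟨β, hβ⟩ := exists_dvd_sq_sub_discr_holds (W.conductorNorm ℤ) K hK hHN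
  obtain ⟨H, -⟩ := nonempty_heegnerDatum_holds (W.conductorNorm ℤ) K hK hβ
  obtain ⟨ι⟩ : Nonempty (K →+* ℂ) := inferInstance
  obtain ⟨P, hP⟩ := hHP (W.conductorNorm ℤ) W K hK hHN Dt H ι
  -- a globally minimal model of the twist (Néron)
  have hD0 : (NumberField.discr K : ℚ) ≠ 0 := by exact_mod_cast NumberField.discr_ne_zero K
  haveI hEt : (W.quadraticTwist (NumberField.discr K : ℚ)).IsElliptic :=
    W.isElliptic_quadraticTwist hD0
  obtain ⟨Cd, hCd⟩ := hasGlobalMinimalModel_rat_holds (W.quadraticTwist (NumberField.discr K : ℚ))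
  haveI : (Cd • W.quadraticTwist (NumberField.discr K : ℚ)).IsGloballyMinimal := hCd
  have hWd : Cd • W.quadraticTwist (NumberField.discr K : ℚ) =
      Cd • W.quadraticTwist (NumberField.discr K : ℚ) := rfl
  obtain ⟨htam, hu⟩ :=
    hTw W p K (Cd • W.quadraticTwist (NumberField.discr K : ℚ)) Cd ⟨hr, hp2, hred, hmult⟩ hK hodd
      hHN hWd
  -- the twist has analytic rank `0`; its print shape from the partner supply
  have hLd1 : (Cd • W.quadraticTwist (NumberField.discr K : ℚ)).entireLFunction 1 ≠ 0 := by
    rw [entireLFunction_smul]; exact hLK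
  have hrd : (Cd • W.quadraticTwist (NumberField.discr K : ℚ)).analyticRank = 0 :=
    ((Cd • W.quadraticTwist _).analyticRank_eq_zero_iff_holds (hmod _)).2 hLd1
  have htw : PPartRankZero (Cd • W.quadraticTwist (NumberField.discr K : ℚ)) p :=
    hpartner K hK hodd hlt hHN hHp hLK (Cd • W.quadraticTwist (NumberField.discr K : ℚ))
      ⟨Cd⁻¹, by rw [inv_smul_smul]⟩ hrd
  -- conclude
  exact bsdp_of_cellC_of_indexIdentityAt W p (W.conductorNorm ℤ) K Dt H ι P (hGZ _ W K) (hKo _ W K)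
    hGZK hmod ⟨hr, hp2, hred, hmult⟩ hK hlt hHN hP hcM hLK
    (Cd • W.quadraticTwist (NumberField.discr K : ℚ)) Cd hWd htw htam hu
    (hHI W p (W.conductorNorm ℤ) K Dt H ι P hp2 hmult hred hr rfl hK hodd hlt hHN hLK hP hcM)

/-- **X2c ∧ ¬(GV) from the typed input over `K`** (published facts, the Manin condition and the
transport package otherwise): for every CellC pair with `¬ GVPar W p` (ψ even: 567 of the 705 census pairs below
`2·10⁴`), `BSD(E,p)` — the partner is in the closed sub-cell X2a. [cite: CastellaEtAl2021, Thm. 5.3.1]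
[cite: GreenbergVatsal2000, Thm. (1.3) with pp. 1, 14–15] [cite: Miller2011LMS, Def. 1.1] -/
theorem bsdp_of_cellC_of_not_gvPar_of_manin
    (hGV : lambdaMu_multiplicative_of_gvPar) (hWu : thm16_charIdeal_dvd_multiplicative_of_reducible)
    (hJs : thm61_splitMultiplicative) (hJn : thm61_nonsplitMultiplicative)
    (hHs : exists_isSplitMultCanonical) (hHn : exists_isMultCanonical)
    (hpar : nonempty_modularParametrizationData)
    (hGS : ∀ (W : WeierstrassCurve ℚ) [W.IsElliptic] [W.IsGloballyMinimal] (p : ℕ) [Fact p.Prime],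
      greenberg_stevens (W := W) (p := p))
    (hGZ : ∀ (N : ℕ) [NeZero N] (W : WeierstrassCurve ℚ) (K : Type) [Field K] [NumberField K],
      gross_zagier N W K)
    (hKo : ∀ (N : ℕ) [NeZero N] (W : WeierstrassCurve ℚ) (K : Type) [Field K] [NumberField K],
      kolyvagin N W K)
    (hHP : ∀ (N : ℕ) [NeZero N] (W : WeierstrassCurve ℚ) (K : Type) [Field K] [NumberField K],
      heegnerPointComplex_mem_range_map N W K)
    (hGZK : rank_eq_analyticRank_of_analyticRank_le_one) (hnf : exists_isNewformOf)
    (hHL : HoffsteinLuo1997_exists_twist_L_one_ne_zero)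
    (hTw : TwistTransportPackage) (hHI : HeegnerIndexIdentity)
    (W : WeierstrassCurve ℚ) [W.IsElliptic] [W.IsGloballyMinimal] (p : ℕ) [Fact p.Prime]
    (hc : CellC W p) (hMan : HasPrimeToManinDatum W p) (hnot : ¬ GVPar W p) : BSDp W p :=
  bsdp_of_cellC_of_manin_of_partner hGZ hKo hHP hGZK hnf hHL hTw hHI W p hc hMan
    (fun K _ _ hK _ _ _ hsplit _ Wd _ _ hWd hrd ↦
      pPartRankZero_twist_of_not_gvPar hGV hWu hJs hJn hHs hHn hGZK
        (WeierstrassCurve.hasEntireLFunction_rat_of_exists_isNewformOf hnf) hpar hGS W p hc.2 hnot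
        K hK hsplit Wd hWd hrd)

/-- **Sub-cell X2c's target from the typed input over `K`, the Manin condition on every CellC pair,
the transport package and sub-cell X2b's target** (X2a being closed): for a CellC pair WITH (GV) (ψ odd, 138 of 705 pairs) the partner
`E^{d_K}` is a rank-`0` X2 pair WITHOUT (GV), i.e. in X2b. [cite: CastellaEtAl2021, Thm. 5.3.1]
[cite: Miller2011LMS, Def. 1.1] -/
theorem targetC_of_heegnerIndexIdentity_of_manin_of_targetB
    (hGV : lambdaMu_multiplicative_of_gvPar) (hWu : thm16_charIdeal_dvd_multiplicative_of_reducible)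
    (hJs : thm61_splitMultiplicative) (hJn : thm61_nonsplitMultiplicative)
    (hHs : exists_isSplitMultCanonical) (hHn : exists_isMultCanonical)
    (hpar : nonempty_modularParametrizationData)
    (hGS : ∀ (W : WeierstrassCurve ℚ) [W.IsElliptic] [W.IsGloballyMinimal] (p : ℕ) [Fact p.Prime],
      greenberg_stevens (W := W) (p := p))
    (hGZ : ∀ (N : ℕ) [NeZero N] (W : WeierstrassCurve ℚ) (K : Type) [Field K] [NumberField K],
      gross_zagier N W K)
    (hKo : ∀ (N : ℕ) [NeZero N] (W : WeierstrassCurve ℚ) (K : Type) [Field K] [NumberField K],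
      kolyvagin N W K)
    (hHP : ∀ (N : ℕ) [NeZero N] (W : WeierstrassCurve ℚ) (K : Type) [Field K] [NumberField K],
      heegnerPointComplex_mem_range_map N W K)
    (hGZK : rank_eq_analyticRank_of_analyticRank_le_one) (hnf : exists_isNewformOf)
    (hHL : HoffsteinLuo1997_exists_twist_L_one_ne_zero)
    (hTw : TwistTransportPackage) (hHI : HeegnerIndexIdentity)
    (hMan : ∀ (W : WeierstrassCurve ℚ) [W.IsElliptic] [W.IsGloballyMinimal] (p : ℕ) [Fact p.Prime],
      CellC W p → HasPrimeToManinDatum W p)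
    (hB : TargetB) : TargetC := by
  intro W _ _ p _ hc
  have hmod' := WeierstrassCurve.hasEntireLFunction_rat_of_exists_isNewformOf hnf
  have h0 : ∀ (W' : WeierstrassCurve ℚ) [W'.IsElliptic] [W'.IsGloballyMinimal],
      ClassX2 W' p → W'.analyticRank = 0 → BSDp W' p := by
    intro W' _ _ hX' hr'
    by_cases hgv : GVPar W' p
    · exact targetA_of_published hGV hWu hJs hJn hHs hHn hGZK hmod' hpar hGS W' p ⟨hr', hX', hgv⟩
    · exact hB W' p ⟨hr', hX', hgv⟩
  exact bsdp_of_cellC_of_manin_of_partner hGZ hKo hHP hGZK hnf hHL hTw hHI W p hc (hMan W p hc)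
    (fun K _ _ hK _ _ _ hsplit _ Wd _ _ hWd hrd ↦
      pPartRankZero_twist_of_rankZero hmod' hGZK W p hc.2 h0 K hK hsplit Wd hWd hrd)

/-- **What remains of class X2 in the kernel after this file**: `X2.Target` follows from the
PUBLISHED named facts, Mazur's main conjecture at every X2b pair (`MissingInputB`), the Heegner-index
identity over `K` at `p ‖ N` (`HeegnerIndexIdentity`, typed), the transport package and the Manin
condition on every CellC pair. Versus
gen 1's `target_of_published_of_missingInputB_of_rankOneDisplay`: Gross–Zagier, Artin formalism,
period relation and the descent of `Ш`/torsion left the typed input. [cite: Miller2011LMS, Def. 1.1 and §1] -/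
theorem target_of_published_of_missingInputB_of_heegnerIndexIdentity
    (hGV : lambdaMu_multiplicative_of_gvPar) (hWu : thm16_charIdeal_dvd_multiplicative_of_reducible)
    (hJs : thm61_splitMultiplicative) (hJn : thm61_nonsplitMultiplicative)
    (hHs : exists_isSplitMultCanonical) (hHn : exists_isMultCanonical)
    (hpar : nonempty_modularParametrizationData)
    (hGS : ∀ (W : WeierstrassCurve ℚ) [W.IsElliptic] [W.IsGloballyMinimal] (p : ℕ) [Fact p.Prime],
      greenberg_stevens (W := W) (p := p))
    (hGZ : ∀ (N : ℕ) [NeZero N] (W : WeierstrassCurve ℚ) (K : Type) [Field K] [NumberField K],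
      gross_zagier N W K)
    (hKo : ∀ (N : ℕ) [NeZero N] (W : WeierstrassCurve ℚ) (K : Type) [Field K] [NumberField K],
      kolyvagin N W K)
    (hHP : ∀ (N : ℕ) [NeZero N] (W : WeierstrassCurve ℚ) (K : Type) [Field K] [NumberField K],
      heegnerPointComplex_mem_range_map N W K)
    (hGZK : rank_eq_analyticRank_of_analyticRank_le_one) (hnf : exists_isNewformOf)
    (hHL : HoffsteinLuo1997_exists_twist_L_one_ne_zero) (hTw : TwistTransportPackage)
    (hMan : ∀ (W : WeierstrassCurve ℚ) [W.IsElliptic] [W.IsGloballyMinimal] (p : ℕ) [Fact p.Prime],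
      CellC W p → HasPrimeToManinDatum W p)
    (hmissB : ∀ (W : WeierstrassCurve ℚ) [W.IsElliptic] [W.IsGloballyMinimal] (p : ℕ) [Fact p.Prime],
      CellB W p → MissingInputB W p)
    (hHI : HeegnerIndexIdentity) : Target :=
  have hmod' := WeierstrassCurve.hasEntireLFunction_rat_of_exists_isNewformOf hnf
  have hB : TargetB := targetB_of_missingInputB hJs hJn hHs hHn hGZK hmod' hpar hGS hmissB
  target_of_targets (targetA_of_published hGV hWu hJs hJn hHs hHn hGZK hmod' hpar hGS) hB
    (targetC_of_heegnerIndexIdentity_of_manin_of_targetB hGV hWu hJs hJn hHs hHn hpar hGS hGZ hKo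
      hHP hGZK hnf hHL hTw hHI hMan hB)

end Summit.BirchSwinnertonDyer.Rank1Residual.X2

end
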